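import Mathlib

/-!
# p1 — kernel-checked certificates for the finite examples of proofs/p1-lattice-calculus.md

(X16): A = B × E with B a CM abelian fourfold whose CM field E_B is Galois over ℚ with group
G = ℤ/4 × ℤ/2, complex conjugation ι = (0,1), CM type Φ_B = {(0,1),(1,1),(2,0),(3,1)}, and E an
elliptic curve with CM by the imaginary quadratic subfield k = E_B^{{(x,0)}}.
The embedding set is Emb = G ⊕ ℤ/2 (Σ_B = G, Σ_k = ℤ/2); Gal(ℚ̄/ℚ) acts through G by translation on
Σ_B and through the quotient G → ℤ/2, t ↦ t.2, on Σ_k; ι acts as +(0,1) on Σ_B and +1 on Σ_k.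
Main statement: every Hodge set of (Emb, Φ) is ι-stable (hence a union of conjugate pairs), so every
rational Hodge class on A is a polynomial in divisor classes; while the weight-3 content
1_{k-fibre} + 2[κ] is balanced (a Weil class of the sixfold B × E²) and not ι-invariant.
-/

namespace HodgeRepro0.P1.X16

/-- the Galois group of E_B, as `Fin 4 × Fin 2` with componentwise modular addition -/
abbrev G := Fin 4 × Fin 2

/-- the embedding set of A = B × E -/
abbrev Emb := G ⊕ Fin 2

/-- complex conjugation on Emb -/
def iota : Emb → Emb
  | Sum.inl g => Sum.inl (g + (0, 1))
  | Sum.inr e => Sum.inr (e + 1)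

/-- the action of t ∈ G on Emb -/
def act (t : G) : Emb → Emb
  | Sum.inl g => Sum.inl (g + t)
  | Sum.inr e => Sum.inr (e + t.2)

/-- the CM type of B -/
def PhiB : Finset G := {(0, 1), (1, 1), (2, 0), (3, 1)}

/-- the CM type of A = B × E (Φ_E = {0}) -/
def Phi : Finset Emb := PhiB.map ⟨Sum.inl, Sum.inl_injective⟩ ∪ {Sum.inr 0}

/-- the set of Galois translates of Φ -/
def translates : Finset (Finset Emb) := Finset.univ.image (fun t : G => Phi.image (act t))

/-- Φ_B is a CM type: exactly one of g, ιg lies in it -/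
theorem PhiB_cmtype : ∀ g : G, (g ∈ PhiB) ≠ (g + (0, 1) ∈ PhiB) := by decide

/-- Φ_B is primitive: no nonzero translation stabilises it -/
theorem PhiB_primitive : ∀ t : G, t ≠ 0 → PhiB.image (· + t) ≠ PhiB := by decide

/-- there are 8 translates of Φ -/
theorem translates_card : translates.card = 8 := by decide

/-- the translate Φ + (0,1)·… (explicit list, see `translates_eq`) -/
def T1 : Finset Emb := {Sum.inl (0,0), Sum.inl (1,0), Sum.inl (2,0), Sum.inl (3,1), Sum.inr 1}
/-- a translate of Φ (explicit) -/
def T2 : Finset Emb := {Sum.inl (0,0), Sum.inl (1,0), Sum.inl (2,1), Sum.inl (3,0), Sum.inr 1}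
/-- a translate of Φ (explicit) -/
def T3 : Finset Emb := {Sum.inl (0,0), Sum.inl (1,1), Sum.inl (2,0), Sum.inl (3,0), Sum.inr 1}
/-- a translate of Φ (explicit) -/
def T4 : Finset Emb := {Sum.inl (0,0), Sum.inl (1,1), Sum.inl (2,1), Sum.inl (3,1), Sum.inr 0}
/-- a translate of Φ (explicit) -/
def T5 : Finset Emb := {Sum.inl (0,1), Sum.inl (1,0), Sum.inl (2,0), Sum.inl (3,0), Sum.inr 1}
/-- a translate of Φ (explicit) -/
def T6 : Finset Emb := {Sum.inl (0,1), Sum.inl (1,0), Sum.inl (2,1), Sum.inl (3,1), Sum.inr 0}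
/-- a translate of Φ (explicit) -/
def T7 : Finset Emb := {Sum.inl (0,1), Sum.inl (1,1), Sum.inl (2,0), Sum.inl (3,1), Sum.inr 0}
/-- a translate of Φ (explicit) -/
def T8 : Finset Emb := {Sum.inl (0,1), Sum.inl (1,1), Sum.inl (2,1), Sum.inl (3,0), Sum.inr 0}

/-- the 8 translates of Φ are T1, …, T8 -/
theorem translates_eq : translates = {T1, T2, T3, T4, T5, T6, T7, T8} := by decide

/-- a subset of Emb given by its characteristic function; `IsHodge s` is the Hodge-set condition
`2·|S ∩ T| = |S|` for every Galois translate T of Φ (p8 §3), written with indicator sums. -/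
def IsHodge (s : Emb → Bool) : Prop :=
  ∀ T ∈ translates, 2 * ∑ x ∈ T, (s x).toNat = ∑ x, (s x).toNat

/-- (X16)(i): every Hodge set of A = B × E is stable under complex conjugation, hence a disjoint
union of conjugate pairs (pair-decomposable). -/
theorem isHodge_iotaStable (s : Emb → Bool) (h : IsHodge s) : ∀ x, s (iota x) = s x := by
  have h1 := h T1 (by rw [translates_eq]; decide)
  have h2 := h T2 (by rw [translates_eq]; decide)
  have h3 := h T3 (by rw [translates_eq]; decide)
  have h4 := h T4 (by rw [translates_eq]; decide)
  have h5 := h T5 (by rw [translates_eq]; decide)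
  have h6 := h T6 (by rw [translates_eq]; decide)
  have h7 := h T7 (by rw [translates_eq]; decide)
  have h8 := h T8 (by rw [translates_eq]; decide)
  simp (config := {decide := true}) only [T1, T2, T3, T4, T5, T6, T7, T8, Finset.sum_insert,
    Finset.sum_singleton, Finset.mem_insert, Finset.mem_singleton, Fintype.sum_sum_type,
    Fintype.sum_prod_type, Fin.sum_univ_four, Fin.sum_univ_two] at h1 h2 h3 h4 h5 h6 h7 h8
  have b00 := Bool.toNat_le (s (Sum.inl (0,0)))
  have b01 := Bool.toNat_le (s (Sum.inl (0,1)))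
  have b10 := Bool.toNat_le (s (Sum.inl (1,0)))
  have b11 := Bool.toNat_le (s (Sum.inl (1,1)))
  have b20 := Bool.toNat_le (s (Sum.inl (2,0)))
  have b21 := Bool.toNat_le (s (Sum.inl (2,1)))
  have b30 := Bool.toNat_le (s (Sum.inl (3,0)))
  have b31 := Bool.toNat_le (s (Sum.inl (3,1)))
  have e0 := Bool.toNat_le (s (Sum.inr 0))
  have e1 := Bool.toNat_le (s (Sum.inr 1))
  have key : (s (Sum.inl (0,1))).toNat = (s (Sum.inl (0,0))).toNat ∧
      (s (Sum.inl (1,1))).toNat = (s (Sum.inl (1,0))).toNat ∧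
      (s (Sum.inl (2,1))).toNat = (s (Sum.inl (2,0))).toNat ∧
      (s (Sum.inl (3,1))).toNat = (s (Sum.inl (3,0))).toNat ∧
      (s (Sum.inr 1)).toNat = (s (Sum.inr 0)).toNat := by omega
  have toNat_eq : ∀ a b : Bool, a.toNat = b.toNat → a = b := by decide
  intro x
  rcases x with ⟨i, j⟩ | e
  · fin_cases i <;> fin_cases j
    · exact toNat_eq _ _ key.1
    · exact toNat_eq _ _ key.1.symm
    · exact toNat_eq _ _ key.2.1
    · exact toNat_eq _ _ key.2.1.symm
    · exact toNat_eq _ _ key.2.2.1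
    · exact toNat_eq _ _ key.2.2.1.symm
    · exact toNat_eq _ _ key.2.2.2.1
    · exact toNat_eq _ _ key.2.2.2.1.symm
  · fin_cases e
    · exact toNat_eq _ _ key.2.2.2.2
    · exact toNat_eq _ _ key.2.2.2.2.symm

/-- the weight-3 content x_0 = 1_{k-fibre through the identity} + 2·[κ] (κ = 0 ∈ Σ_k) -/
def x0 : Emb → ℕ
  | Sum.inl g => if g.2 = 0 then 1 else 0
  | Sum.inr e => if e = 0 then 2 else 0

/-- (X16)(ii): x_0 is balanced of weight 3 (a Hodge class of degree 6 on B × E², via any realisation) -/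
theorem x0_balanced : ∀ T ∈ translates, ∑ x ∈ T, x0 x = 3 := by
  intro T hT
  obtain ⟨t, -, rfl⟩ := Finset.mem_image.mp hT
  rcases t with ⟨a, b⟩
  fin_cases a <;> fin_cases b <;> decide

/-- x_0 is not ι-invariant (so its class in 𝓗/Π is nonzero) -/
theorem x0_not_iotaInvariant : ¬ (∀ x, x0 (iota x) = x0 x) := by decide

/-- the Galois orbit of x_0 is {x_0, x_0∘ι}: t ∈ G fixes x_0 if t.2 = 0 and maps it to x_0∘ι otherwise -/
theorem x0_orbit : ∀ t : G, ∀ x, x0 (act t x) = (if t.2 = 0 then x0 x else x0 (iota x)) := by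
  intro t
  rcases t with ⟨a, b⟩
  fin_cases a <;> fin_cases b <;> decide

/-- the primitive generator w_1 of the lattice 𝓛 = ℤ[Emb]^- ∩ U (values ±1 on Σ_B, ±2 on Σ_k) -/
def w1 : Emb → ℤ
  | Sum.inl g => if g.2 = 0 then 1 else -1
  | Sum.inr e => if e = 0 then 2 else -2

/-- (X16)(ii), rank statement: every ι-anti-invariant integer vector orthogonal to all translates of Φ
is an integer multiple of w_1; so rank(𝓗/Π) = 1 with generator x_0 = w_1⁺. -/
theorem lattice_rank_one (y : Emb → ℤ) (hanti : ∀ x, y (iota x) = - y x)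
    (horth : ∀ T ∈ translates, ∑ x ∈ T, y x = 0) : ∃ c : ℤ, ∀ x, y x = c * w1 x := by
  have h1 := horth T1 (by rw [translates_eq]; decide)
  have h2 := horth T2 (by rw [translates_eq]; decide)
  have h3 := horth T3 (by rw [translates_eq]; decide)
  have h4 := horth T4 (by rw [translates_eq]; decide)
  have h5 := horth T5 (by rw [translates_eq]; decide)
  have h6 := horth T6 (by rw [translates_eq]; decide)
  have h7 := horth T7 (by rw [translates_eq]; decide)
  have h8 := horth T8 (by rw [translates_eq]; decide)
  simp (config := {decide := true}) only [T1, T2, T3, T4, T5, T6, T7, T8, Finset.sum_insert,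
    Finset.sum_singleton, Finset.mem_insert, Finset.mem_singleton] at h1 h2 h3 h4 h5 h6 h7 h8
  have a0 : y (Sum.inl (0,1)) = - y (Sum.inl (0,0)) := hanti (Sum.inl (0,0))
  have a1 : y (Sum.inl (1,1)) = - y (Sum.inl (1,0)) := hanti (Sum.inl (1,0))
  have a2 : y (Sum.inl (2,1)) = - y (Sum.inl (2,0)) := hanti (Sum.inl (2,0))
  have a3 : y (Sum.inl (3,1)) = - y (Sum.inl (3,0)) := hanti (Sum.inl (3,0))
  have a4 : y (Sum.inr 1) = - y (Sum.inr 0) := hanti (Sum.inr 0)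
  have w00 : w1 (Sum.inl (0,0)) = 1 := by decide
  have w01 : w1 (Sum.inl (0,1)) = -1 := by decide
  have w10 : w1 (Sum.inl (1,0)) = 1 := by decide
  have w11 : w1 (Sum.inl (1,1)) = -1 := by decide
  have w20 : w1 (Sum.inl (2,0)) = 1 := by decide
  have w21 : w1 (Sum.inl (2,1)) = -1 := by decide
  have w30 : w1 (Sum.inl (3,0)) = 1 := by decide
  have w31 : w1 (Sum.inl (3,1)) = -1 := by decide
  have we0 : w1 (Sum.inr 0) = 2 := by decide
  have we1 : w1 (Sum.inr 1) = -2 := by decide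
  refine ⟨y (Sum.inl (0,0)), ?_⟩
  have f00 : y (Sum.inl (0,0)) = y (Sum.inl (0,0)) * w1 (Sum.inl (0,0)) := by rw [w00]; omega
  have f01 : y (Sum.inl (0,1)) = y (Sum.inl (0,0)) * w1 (Sum.inl (0,1)) := by rw [w01]; omega
  have f10 : y (Sum.inl (1,0)) = y (Sum.inl (0,0)) * w1 (Sum.inl (1,0)) := by rw [w10]; omega
  have f11 : y (Sum.inl (1,1)) = y (Sum.inl (0,0)) * w1 (Sum.inl (1,1)) := by rw [w11]; omega
  have f20 : y (Sum.inl (2,0)) = y (Sum.inl (0,0)) * w1 (Sum.inl (2,0)) := by rw [w20]; omega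
  have f21 : y (Sum.inl (2,1)) = y (Sum.inl (0,0)) * w1 (Sum.inl (2,1)) := by rw [w21]; omega
  have f30 : y (Sum.inl (3,0)) = y (Sum.inl (0,0)) * w1 (Sum.inl (3,0)) := by rw [w30]; omega
  have f31 : y (Sum.inl (3,1)) = y (Sum.inl (0,0)) * w1 (Sum.inl (3,1)) := by rw [w31]; omega
  have fe0 : y (Sum.inr 0) = y (Sum.inl (0,0)) * w1 (Sum.inr 0) := by rw [we0]; omega
  have fe1 : y (Sum.inr 1) = y (Sum.inl (0,0)) * w1 (Sum.inr 1) := by rw [we1]; omega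
  intro x
  rcases x with ⟨i, j⟩ | e
  · fin_cases i <;> fin_cases j
    · exact f00
    · exact f01
    · exact f10
    · exact f11
    · exact f20
    · exact f21
    · exact f30
    · exact f31
  · fin_cases e
    · exact fe0
    · exact fe1

end HodgeRepro0.P1.X16

/-!
(X13): E Galois over ℚ with group G = ℤ/8 × ℤ/2, ι = (0,1), and the primitive CM type
Φ = {(0,0),(1,0),(2,0),(3,1),(4,1),(5,0),(6,1),(7,1)} (g = 8). The index-2 subgroups H_1 = {x_2 = 0},
H_2 = {x_1 + x_2 even} (imaginary quadratic subfields K_1, K_2) and H_12 = H_1 ∩ H_2 (the biquadratic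
subfield F = K_1K_2) give Hodge sets; the lattice 𝓗 is generated over Π by the two F-Weil cosets, and
Π + ℤ·1_{H_1} + ℤ·1_{H_2} has index 2 in it (certificate: the parity of λ(x) = x(0,0) − x(0,1) − x(1,0) + x(1,1)).
-/

namespace HodgeRepro0.P1.X13

/-- the Galois group ℤ/8 × ℤ/2 -/
abbrev G := Fin 8 × Fin 2

/-- complex conjugation ι = translation by (0,1) -/
def iota (g : G) : G := g + (0, 1)

/-- the CM type Φ -/
def Phi : Finset G := {(0,0), (1,0), (2,0), (3,1), (4,1), (5,0), (6,1), (7,1)}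

/-- the Galois translates of Φ -/
def translates : Finset (Finset G) := Finset.univ.image (fun t : G => Phi.image (· + t))

/-- Φ is a CM type -/
theorem Phi_cmtype : ∀ g : G, (g ∈ Phi) ≠ (iota g ∈ Phi) := by decide

/-- Φ is primitive (trivial translation stabiliser) -/
theorem Phi_primitive : ∀ t : G, t ≠ 0 → Phi.image (· + t) ≠ Phi := by decide

/-- Φ has 16 distinct translates -/
theorem translates_card : translates.card = 16 := by decide

/-- the index-2 subgroup H_1 = {x_2 = 0} -/
def H1 : Finset G := Finset.univ.filter (fun g => g.2 = 0)
/-- the index-2 subgroup H_2 = {x_1 + x_2 even} -/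
def H2 : Finset G := Finset.univ.filter (fun g => (g.1.val + g.2.val) % 2 = 0)
/-- the index-4 subgroup H_12 = H_1 ∩ H_2 -/
def H12 : Finset G := Finset.univ.filter (fun g => g.1.val % 2 = 0 ∧ g.2 = 0)

/-- Hodge-set condition for a subset S ⊂ G: `2·|S ∩ tΦ| = |S|` for every translate tΦ, t ∈ G -/
def IsHodge (S : Finset G) : Prop := ∀ t : G, 2 * (S ∩ Phi.image (· + t)).card = S.card

/-- H_1 is a Hodge set (Weil classes relative to K_1, degree 8) -/
theorem H1_isHodge : IsHodge H1 := by
  intro t; rcases t with ⟨a, b⟩; fin_cases a <;> fin_cases b <;> decide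
/-- H_2 is a Hodge set (Weil classes relative to K_2, degree 8) -/
theorem H2_isHodge : IsHodge H2 := by
  intro t; rcases t with ⟨a, b⟩; fin_cases a <;> fin_cases b <;> decide
/-- H_12 is a Hodge set (Weil classes relative to the biquadratic field F, degree 4) -/
theorem H12_isHodge : IsHodge H12 := by
  intro t; rcases t with ⟨a, b⟩; fin_cases a <;> fin_cases b <;> decide
/-- H_12 is not ι-stable: its Weil classes are not divisor-generated -/
theorem H12_not_iotaStable : H12.image iota ≠ H12 := by decide

/-- indicator functions -/
def ind (S : Finset G) (g : G) : ℤ := if g ∈ S then 1 else 0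

/-- (X13), the index-two certificate: no integer vector of the form π + a·1_{H_1} + b·1_{H_2} with π
ι-invariant equals 1_{H_12}: the functional λ(x) = x(0,0) − x(0,1) − x(1,0) + x(1,1) is even on the
former and equals 1 on the latter. -/
theorem H12_not_in_sublattice (π : G → ℤ) (a b : ℤ) (hπ : ∀ g, π (iota g) = π g) :
    ¬ (∀ g, π g + a * ind H1 g + b * ind H2 g = ind H12 g) := by
  intro h
  have e00 := h (0,0)
  have e01 := h (0,1)
  have e10 := h (1,0)
  have e11 := h (1,1)
  have p0 : π (0,1) = π (0,0) := hπ (0,0)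
  have p1 : π (1,1) = π (1,0) := hπ (1,0)
  have v1 : ind H1 (0,0) = 1 := by decide
  have v2 : ind H1 (0,1) = 0 := by decide
  have v3 : ind H1 (1,0) = 1 := by decide
  have v4 : ind H1 (1,1) = 0 := by decide
  have u1 : ind H2 (0,0) = 1 := by decide
  have u2 : ind H2 (0,1) = 0 := by decide
  have u3 : ind H2 (1,0) = 0 := by decide
  have u4 : ind H2 (1,1) = 1 := by decide
  have t1 : ind H12 (0,0) = 1 := by decide
  have t2 : ind H12 (0,1) = 0 := by decide
  have t3 : ind H12 (1,0) = 0 := by decide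
  have t4 : ind H12 (1,1) = 0 := by decide
  rw [v1, u1, t1] at e00
  rw [v2, u2, t2] at e01
  rw [v3, u3, t3] at e10
  rw [v4, u4, t4] at e11
  omega

end HodgeRepro0.P1.X13
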